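import Literature.NumberTheory.EllipticCurves.HeightFamily
import HarnessLib

/-!
# Lower height densities: intersections, density-one sets, everywhere-true properties

Elementary algebra of the tree's `HeightDensityGE P δ` ("at least a proportion `δ` of elliptic curves
`E_{A,B}/ℚ`, ordered by naive height, satisfy `P`", `HeightFamily.lean`), PROVED from the definitions
(finite sums; no named fact). Companion to `BhargavaSkinnerZhang2014/CellUnion.lean`, which proves
monotonicity in `P` (`HeightDensityGE.mono`) and in `δ` (`.of_le`) and ADDITIVITY over disjoint cells
(`.add_disjoint`, `heightDensityGE_of_cells`); this file adds the INTERSECTION side: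

* `heightProportion_and_ge` — inclusion–exclusion, `prop(P ∧ Q) ≥ prop P + prop Q − 1`;
* `HeightDensityGE.and` — lower densities `a`, `b` ⇒ lower density `a + b − 1` for `P ∧ Q`;
* `HeightDensityGE.and_of_one` / `.one_and` — intersecting with a density-one property costs nothing
  (the binder `DensityInterOne` of the typed THEOREM_{S_go} of `PERCENT-FULL.md` §5, cell `pub-bsdpct`);
* `zeroOne_mem_heightFamilyBelow`, `heightProportion_of_forall`, `heightDensityGE_one_of_forall` — the
  curve `y² = x³ + 1` has naive height `27`, so the family below height `X ≥ 28` is nonempty, a property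
  holding on every member of the family has proportion exactly `1` from `X = 28` on, hence density one;
  `HeightDensityGE.and_forall` — adding such a property to any `P` keeps its lower density;
* `HeightDensityGE.finset_forall_one` — a finite intersection of density-one properties has density one.

Sources: folklore (finite inclusion–exclusion); used as in Bhargava–Skinner–Zhang, arXiv:1407.1826 §3
(removing a density-zero set does not change a proportion) and `PERCENT-FULL.md` §(ii).2 (L).
-/

namespace Literature.NumberTheory.EllipticCurves

open scoped Classical
open Filter Topology Finset

/-! ### Inclusion–exclusion for proportions -/

/-- Inclusion–exclusion lower bound for proportions below a fixed height:
`prop(P) + prop(Q) − 1 ≤ prop(P ∧ Q)` (also true with the junk value `0` when no curve has height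
`< X`, the left side being `−1`). [folklore] -/
theorem heightProportion_and_ge (P Q : ℤ × ℤ → Prop) (X : ℕ) :
    heightProportion P X + heightProportion Q X - 1 ≤
      heightProportion (fun AB ↦ P AB ∧ Q AB) X := by
  unfold heightProportion heightAverage
  set s := heightFamilyBelow X with hs
  by_cases hc : s.card = 0
  · have hs0 : s = ∅ := Finset.card_eq_zero.mp hc
    simp [hs0]
  · have hcpos : (0 : ℝ) < s.card := by exact_mod_cast Nat.pos_of_ne_zero hc
    rw [le_div_iff₀ hcpos]
    have e : ((∑ AB ∈ s, (if P AB then (1 : ℝ) else 0)) / s.card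
        + (∑ AB ∈ s, (if Q AB then (1 : ℝ) else 0)) / s.card - 1) * s.card
        = (∑ AB ∈ s, (if P AB then (1 : ℝ) else 0)) + (∑ AB ∈ s, (if Q AB then (1 : ℝ) else 0))
          - s.card := by
      field_simp
    have hcard : (s.card : ℝ) = ∑ AB ∈ s, (1 : ℝ) := by simp
    rw [e, hcard, ← Finset.sum_add_distrib, ← Finset.sum_sub_distrib]
    refine Finset.sum_le_sum fun AB _ ↦ ?_
    by_cases hP : P AB <;> by_cases hQ : Q AB <;> simp [hP, hQ]

/-! ### Intersections of lower densities -/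

/-- Lower densities of an intersection: if at least a proportion `a` satisfy `P` and at least `b`
satisfy `Q`, then at least `a + b − 1` satisfy both. [folklore] -/
theorem HeightDensityGE.and {P Q : ℤ × ℤ → Prop} {a b : ℝ} (hP : HeightDensityGE P a)
    (hQ : HeightDensityGE Q b) : HeightDensityGE (fun AB ↦ P AB ∧ Q AB) (a + b - 1) := by
  intro ε hε
  filter_upwards [hP (ε / 2) (by positivity), hQ (ε / 2) (by positivity)] with X hX1 hX2
  have := heightProportion_and_ge P Q X
  linarith

/-- **Intersecting with a density-one set costs nothing**: if at least a proportion `δ` satisfy `P`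
and `Q` has (lower) density one, then at least a proportion `δ` satisfy `P ∧ Q`. This is the
binder `DensityInterOne` of `PERCENT-FULL.md` §5 (cell `pub-bsdpct`). [folklore] -/
theorem HeightDensityGE.and_of_one {P Q : ℤ × ℤ → Prop} {δ : ℝ} (hP : HeightDensityGE P δ)
    (hQ : HeightDensityGE Q 1) : HeightDensityGE (fun AB ↦ P AB ∧ Q AB) δ := by
  have h := hP.and hQ
  have e : δ + 1 - 1 = δ := by ring
  rw [e] at h
  exact h

/-- Symmetric form: the density-one set first. [folklore] -/
theorem HeightDensityGE.one_and {P Q : ℤ × ℤ → Prop} {δ : ℝ} (hP : HeightDensityGE P 1)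
    (hQ : HeightDensityGE Q δ) : HeightDensityGE (fun AB ↦ P AB ∧ Q AB) δ := by
  have h := hP.and hQ
  have e : (1 : ℝ) + δ - 1 = δ := by ring
  rw [e] at h
  exact h

/-! ### Everywhere-true properties have density one -/

/-- The curve `E_{0,1} : y² = x³ + 1` is in the family (no prime `q` has `q⁶ ∣ 1`) with naive height
`max(0, 27) = 27`, so it lies below every height bound `X ≥ 28`; in particular the family below such
`X` is nonempty. [folklore] -/
theorem zeroOne_mem_heightFamilyBelow {X : ℕ} (hX : 28 ≤ X) :
    ((0 : ℤ), (1 : ℤ)) ∈ heightFamilyBelow X := by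
  rw [mem_heightFamilyBelow_iff]
  refine ⟨⟨by norm_num, ?_⟩, ?_⟩
  · rintro q hq ⟨-, h6⟩
    have h1 : ((q : ℤ) ^ 6).natAbs ∣ (1 : ℤ).natAbs := Int.natAbs_dvd_natAbs.mpr h6
    simp only [Int.natAbs_pow, Int.natAbs_natCast, Int.natAbs_one, Nat.dvd_one] at h1
    have hq1 := hq.one_lt
    have hle : q ≤ q ^ 6 := Nat.le_self_pow (by norm_num) q
    omega
  · have hX' : (28 : ℤ) ≤ (X : ℤ) := by exact_mod_cast hX
    unfold naiveHeight
    simp only [abs_zero, one_pow, mul_one]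
    rw [max_lt_iff]
    constructor <;> linarith

/-- A property holding on EVERY member of the height family has proportion exactly `1` below every
height bound `X ≥ 28` (below `X = 28` the family may be empty and the proportion is the junk `0`).
[folklore] -/
theorem heightProportion_of_forall {P : ℤ × ℤ → Prop} (h : ∀ AB, IsInHeightFamily AB → P AB)
    {X : ℕ} (hX : 28 ≤ X) : heightProportion P X = 1 := by
  unfold heightProportion heightAverage
  have hsum : (∑ AB ∈ heightFamilyBelow X, (if P AB then (1 : ℝ) else 0))
      = (heightFamilyBelow X).card := by
    rw [Finset.card_eq_sum_ones, Nat.cast_sum]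
    refine Finset.sum_congr rfl fun AB hAB ↦ ?_
    have hP : P AB := h AB ((mem_heightFamilyBelow_iff AB X).mp hAB).1
    simp [hP]
  rw [hsum]
  have hne : ((heightFamilyBelow X).card : ℝ) ≠ 0 := by
    have : 0 < (heightFamilyBelow X).card :=
      Finset.card_pos.mpr ⟨_, zeroOne_mem_heightFamilyBelow hX⟩
    exact_mod_cast this.ne'
  exact div_self hne

/-- A property holding on every member of the height family has (lower) density one. [folklore] -/
theorem heightDensityGE_one_of_forall {P : ℤ × ℤ → Prop} (h : ∀ AB, IsInHeightFamily AB → P AB) :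
    HeightDensityGE P 1 := by
  intro ε hε
  filter_upwards [eventually_ge_atTop 28] with X hX
  rw [heightProportion_of_forall h hX]
  linarith

/-- Adding an everywhere-true side condition to `P` keeps its lower density. [folklore] -/
theorem HeightDensityGE.and_forall {P Q : ℤ × ℤ → Prop} {δ : ℝ} (hP : HeightDensityGE P δ)
    (hQ : ∀ AB, IsInHeightFamily AB → Q AB) : HeightDensityGE (fun AB ↦ P AB ∧ Q AB) δ :=
  hP.and_of_one (heightDensityGE_one_of_forall hQ)

/-! ### Finite intersections of density-one properties -/

/-- A finite intersection of density-one properties has density one. [folklore] -/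
theorem HeightDensityGE.finset_forall_one {ι : Type*} (s : Finset ι) (P : ι → ℤ × ℤ → Prop)
    (h : ∀ i ∈ s, HeightDensityGE (P i) 1) :
    HeightDensityGE (fun AB ↦ ∀ i ∈ s, P i AB) 1 := by
  classical
  induction s using Finset.induction_on with
  | empty =>
    have e : (fun AB : ℤ × ℤ ↦ ∀ i ∈ (∅ : Finset ι), P i AB) = fun _ ↦ True := by
      funext AB
      simp
    rw [e]
    exact heightDensityGE_one_of_forall fun _ _ ↦ trivial
  | @insert a s ha ih =>
    have h1 : HeightDensityGE (P a) 1 := h a (Finset.mem_insert_self a s)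
    have h2 : HeightDensityGE (fun AB ↦ ∀ i ∈ s, P i AB) 1 :=
      ih fun i hi ↦ h i (Finset.mem_insert_of_mem hi)
    have e : (fun AB : ℤ × ℤ ↦ ∀ i ∈ insert a s, P i AB) = fun AB ↦ P a AB ∧ ∀ i ∈ s, P i AB := by
      funext AB
      exact propext (Finset.forall_mem_insert a s fun i ↦ P i AB)
    rw [e]
    exact h1.and_of_one h2

end Literature.NumberTheory.EllipticCurves
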